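import Summits.QuantumFields.YangMills.Theorems.BalabanUVNodesN27AtReadingOfRecord13CoPH
import Summits.QuantumFields.YangMills.Theorems.BalabanUVNodesN22EdgeAtW1AdmReadingOfRecord13CoPH
import Summits.QuantumFields.YangMills.Theorems.BalabanUVNodesN18AtRateRecord13CoPH

/-!
# BalabanUVNodes ∕ N27 = binder B5 AT THE RECORD, XLIᶜᵒᴾᴴ — N27 AT THE ADMISSIBLE CoPH-KEYED STAGE-13 READING OF RECORD: XLᶜᵒᴾᴴ's two knits INSTANTIATED at node00-def-W1's ADMISSIBLE reading
# `ReadingData.ofRecordAdm` (θ-level), N22 ELIMINATED GIVEN N18 by dag-n22-e 8a″ᶜᵒᴾᴴ `…N22EdgeAtW1AdmReadingOfRecord13CoPH`, N18 by dag-n18-d's Co twin of module 18 (envelope face; the closed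
# form `n18At_u3OfRecord₁₃_readingAdm_iff` is θ-level): THE v1.7 `CoPH` EDITION OF MODULE XLI `…N27AtAdmReadingOfRecord13` §§1–2 (p498007 ‴ ∕ p512301 ⁗; §3 knitN15 follows append-only when
# dag-n15-a's part-33 face has a Co twin); regime-generic
# (cell `pub-ymgap`, HUMAN RULING D-0062 Track A, R134 seat `pub-ymgap-dag-n27-c` (s2) gen 9; `--kind proof --supports <K3 id of record> --as helper`; COUNT-NEUTRAL; `N`-generic, NO Theses import)

WHY THIS EDITION (v1.7 `CoPH` = RECORD 13 WITH THE HISTORY-INDEXED RESIDUAL 𝐓-WEIGHT SLOT `Zh p n Ω Λ` (+ the history-indexed §2 smearing `Phih`) — FINDING №9, director-ym №183 H1ʰ ∕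
№186 DESIGN (α) WHOLE-HISTORY ∕ №190 PRESS WORD; def-T FILE 27 `Node00/Record13CoPH.lean` p537939 ✓ + 28T `Node00/Record13SepCoPH.lean` p539169 ✓, RR-2 `Node00/Record13DatumKeyCoPH.lean` ∕
`…KeySepCoPH.lean` ✓ (guard `unityNondeg₁₃H`); route rev 24∕25, dag-lead WORDS-143: K3⁷ `SpineGivenEndpointR13SepCoPH` = stmt-QuantumFields-20544, the ⁶ items aside): this file is the T₇ image of my v1.6
storey `…N27AtAdmReadingOfRecord13CoPR (XLIᶜᵒᴾᴿ)` (p540691 ✓), which STANDS as a landed sibling — binder `θ : Node00.Stage13RParams F N ↦ θ : Node00.Stage13HParams F N` (`extends Stage13RParams` by the fields `Zh`, `Phih`),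
core provisos `θ.Provisos₁₃CoPR ↦ θ.Provisos₁₃CoPH` (rows `zhLaws ∕ zhLocal`), datum ∕ tower ∕ record ∕ shadow ∕ faces `…₁₃CoPR ↦ …₁₃CoPH` (`datumOfRecord₁₃CoPH θ h` reads the history's
𝐓-weights `WtOfRecord₁₃H θ p s`), guard `θ.ZrUnity ↦ θ.ZhUnity` (RR-2 `unityNondeg₁₃R ↦ unityNondeg₁₃H`), RR-2's ∕ the carriers' ∕ my stems `CoPR ↦ CoPH`; the two SITE-RULE sites of the v1.6
image (`u3OfRecord₁₃ θ.toStage13Params`, the θ-level junction `n18At_u3OfRecord₁₃_readingAdm_iff θ.toStage13Params`) are UNCHANGED — `θ.toStage13Params`, `θ.γ`, `θ.τ9`, `θ.Admissible`,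
`θ.SlotsNondegenerate₁₃`, `θ.toStage12Params` resolve through the two-level `extends`.  bg-BLIND and proviso-FIELD-blind as before: the provisos enter ONLY as the binder type
`hc : θ.Provisos₁₃CoPH F N` and inside `datumOfRecord₁₃CoPH F N θ hc` (keyed ONCE; the item edition's tuple `(θ, h : θ.Provisos₁₃SepCoPH F N)` applies it at `hc := h.toCore`, datum `rfl` by
def-T's `datumOfRecord₁₃SepCoPH_eq_coPH`).  Statements AND proofs = the v1.6 module's, token for token under T₇; NO bridge to ∕ from the v1.6 storeys is stated (different data: `Zh p n Ω Λ`
per history vs `Zr p` per run; the ONE-WAY door ⁶ → ⁷ is def-T's `Stage13HParams.ofHistoryBlind`).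

WHAT IS KERNEL-CHECKED ([bookkeeping]; 0 `def`, 0 `sorry`; every estimate ∕ clause a HYPOTHESIS — 0∕1 at the ₁₃ record today).
* §1 `spine_rec13CCoPH_at_readingAdm₁₃CoPH` — CANONICAL HOME: NE1′ on `ne1`, NE2 on `ne2` at `h.params`; NE3 as `InEndRegime ∧ LeafSlot` once per family (dag-n16-e module 19 §5); N17
  ELIMINATED; N18 in stub form `S_N18 (RRec₁₃CoPH 𝔯_adm)`; N22 ELIMINATED given `h18` by `YMDAG.N22.s_N22_readingOfRecord₁₃CoPH_ofRecordAdm_of_s_N18_analytic` — (J), (A) over ADMISSIBLE run-A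
  fields, eleven numerals VERBATIM; (D4) on the admissible bundles; spine side N20 ∕ N21 ∕ extraction at `SRec₁₃CoPH cr`, home-keyed N19′ edge ⇒ `Spine ₁₃CCoPH`.
* §1 (2) `spine_rec13CCoPH_at_readingAdm₁₃CoPH_of_envelope_bound238` — N18 ⟸ dag-n18-d module 18 `s_N18_rRec₁₃CoPH_readingAdm_of_envelope_bound238_pin` (THE END's data + the (2.38) envelope ON
  THE TABLES, VERBATIM).
* §2 `spine_rec13CCoPHOn_at_readingAdm₁₃CoPH` — REGIME HOME, any `Rg`: the same read AT θ for tuples IN THE REGIME; N18 DISPLAYED IN CLOSED FORM at θ (dag-n18-d module 18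
  `n18At_u3OfRecord₁₃_readingAdm_iff`, `Iff.rfl`); N22 ELIMINATED by `YMDAG.N22.s_N22_readingOfRecord₁₃CoPHOn_ofRecordAdm_of_s_N18_stripBound` — (J), twelve numerals, STRIP-(1.18) on the reading's OWN
  table `sp F θ k` VERBATIM (BY TYPE at the admissible reading, no readings clause) ⇒ `Spine (IsRecordOfRecord₁₃CCoPHOn Rg)`; at `Rg := Node00.unityNondeg₁₃H 2` = THE ITEM (XXXVII-class leaf §4).

HONEST FRAMING.  COUNT-NEUTRAL kernel bookkeeping BY NAME at a COMPOSITE node; the admissible reading's towers ∕ tables ∕ gauges ∕ transport ∕ letters are residual DATA in named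
containers; (J), (A), STRIP-(1.18), the numerals, NE1′, NE2, `InEndRegime ∧ LeafSlot`, NE5, (D4), NE7b, NE7c, the extraction clause and NE7's core edge are DISPLAYED hypotheses with no
producer at the ₁₃ reading today; nothing of Bałaban's asserted or instantiated; no ₁₃ inhabitant claimed (K0 of the edition, open); N27 ∕ N22 ∕ N18 NOT
discharged, K3 NOT claimed; counts UNMOVED (typed 28∕28 · discharged 5∕27, A 5∕28); one finite four-torus programme at fixed `ε` — NOT ℝ⁴, NOT infinite volume, NOT OS, NOT a mass
gap, NOT Clay.  No decl below carries a cite tag.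
-/

namespace Summit.QuantumFields.YangMills.Theorems.BalabanUVNodesN27SpineRecord

open Set Metric
open scoped Matrix.Norms.L2Operator

open Literature.MathematicalPhysics.QuantumFieldTheory.Balaban1983to89
open Literature.MathematicalPhysics.QuantumFieldTheory.Balaban1983to89.T4Continuum
open Literature.MathematicalPhysics.QuantumFieldTheory.Balaban1983to89.T4OutputRate (Carriers Functional NE5 DecayBound Window)
open Literature.MathematicalPhysics.QuantumFieldTheory.Balaban1983to89.TreeLengthTorus (TDom tsys torusTreeLen)
open Literature.MathematicalPhysics.QuantumFieldTheory.Balaban1983to89.T4InputCauchyRateData (StepModel)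
open Literature.MathematicalPhysics.QuantumFieldTheory.Balaban1983to89.B13Resummation (locE)
open Literature.MathematicalPhysics.QuantumFieldTheory.Balaban1983to89.TreeLengthTorusGeometry (TTouch)
open Literature.MathematicalPhysics.QuantumFieldTheory.Balaban1983to89.B12TreeDecay (K₀)
open Summit.QuantumFields.BalabanUV.T4Continuum.Spine.NE5
open YMDAG.N18.HLayer
open YMDAG.N18.W1Reading (s_N18_rRec₁₃CoPH_readingAdm_of_envelope_bound238_pin n18At_u3OfRecord₁₃_readingAdm_iff)
open T4ContinuumYM4Torus (ForSmallCouplings)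
open Summit.QuantumFields.BalabanUV.T4Continuum.Spine
open YMDAG.UVSplit
open Node00 (Stage13HParams datumOfRecord₁₃CoPH IsRecordOfRecord₁₃CCoPH IsDatumOfRecord₁₃CCoPH NE3Letters₁₁ NE2Objects₁₁ ne3ConstLayerOfRecord₁₁ MatA ιSU prependCoupling)
open Node00.Sect2 (domCount domSys CPair ofBackgroundC)
open Node00.W1 (ReadingData LevelPairing LetterInputs ClusterTower pairOfRecord functionalC termC box SpRestr AdmBg)
open YMDAG.N22 (s_N22_readingOfRecord₁₃CoPH_ofRecordAdm_of_s_N18_analytic s_N22_readingOfRecord₁₃CoPHOn_ofRecordAdm_of_s_N18_stripBound)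
open Summit.QuantumFields.YangMills.BalabanUVNodes.N16Regime (InEndRegime)
open Summit.QuantumFields.YangMills.BalabanUVNodes.N16LeafSlot (LeafSlot)
open Summit.QuantumFields.YangMills.BalabanUVNodes.N16AtRRec13CoPH (s_N16_rRec₁₃CoPH_of_constLayer_leafSlot s_N16_rRec₁₃CoPHOn_ofRecord_of_leafSlot)

variable {N : ℕ} [NeZero N] (cr : SpineReading₁₃CoPH N)
  (S : (F : T4Family) → (θ : Stage13HParams F N) → (k : ℕ) → ClusterTower (F.P k) (MatA N) θ.τ9.M)
  (sp : (F : T4Family) → (θ : Stage13HParams F N) → (k j : ℕ) → (domSys (F.P k) θ.τ9.M j).Dom → Set (CPair (F.P k) (MatA N)))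
  (gauge : (F : T4Family) → (θ : Stage13HParams F N) → (k : ℕ) → GaugeField (F.P k) 0 (Node00.SU N) → GaugeField (F.P k) 0 (Node00.SU N) → ℝ)
  (hg : ∀ (F : T4Family) (θ : Stage13HParams F N) (k : ℕ) (U U' : GaugeField (F.P k) 0 (Node00.SU N)), 0 ≤ gauge F θ k U U')
  (T₀ : (F : T4Family) → (θ : Stage13HParams F N) → (k : ℕ) → GaugeField (F.P (k + 1)) 0 (Node00.SU N) → GaugeField (F.P k) 0 (Node00.SU N))
  (hT₀ : ∀ (F : T4Family) (θ : Stage13HParams F N) (k : ℕ) (U : GaugeField (F.P (k + 1)) 0 (Node00.SU N)),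
    (∀ (j : ℕ) (Y : (domSys (F.P (k + 1)) θ.τ9.M j).Dom), ofBackgroundC (ιSU N) U ∈ sp F θ (k + 1) j Y) →
      ∀ (j : ℕ) (X : (domSys (F.P k) θ.τ9.M j).Dom), ofBackgroundC (ιSU N) (T₀ F θ k U) ∈ sp F θ k j X)
  (li : (F : T4Family) → Stage13HParams F N → LetterInputs) (ℓ₃ : T4Family → NE3Letters₁₁)
  (ne2 : (F : T4Family) → Stage13HParams F N → (ℕ → ℝ) → List (ULoop F) → ℕ → NE2Objects₁₁)
  (ne1 : (F : T4Family) → Stage13HParams F N → (ℕ → ℝ) → List (ULoop F) → NE1pCarriers)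

/-! ## §1 The canonical home at the admissible reading of record -/

section Canonical

/-- **N27 = B5 AT THE STAGE-12 RECORD FROM THE SLOTS AT THE CANONICAL HOME OF THE ADMISSIBLE READING OF RECORD — N17 AND N22 ELIMINATED, N18 IN STUB FORM**
(XLᶜᵒᴾᴴ `spine_rec13CCoPH_at_readingOfRecord₁₃CoPH` at `w1 := fun F θ ↦ ReadingData.ofRecordAdm F θ.τ9.M N (S F θ) (sp F θ) (gauge F θ) (hg F θ) (T₀ F θ) (hT₀ F θ) (li F θ)`).
Rate side: NE1′ on `ne1` and NE2 on `ne2` read at the datum key's parameter `h.params` (displayed); NE3 as `InEndRegime ∧ LeafSlot` at RR-1's layer once per family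
(dag-n16-e module 19 `s_N16_rRec₁₃CoPH_of_constLayer_leafSlot`); N18 in stub form `S_N18 (RRec₁₃CoPH 𝔯_adm)` (dag-n18-d's ₁₃ producer pending); N22 ELIMINATED given `h18` by
dag-n22-e's `YMDAG.N22.s_N22_readingOfRecord₁₃CoPH_ofRecordAdm_of_s_N18_analytic` (module 8a″) — its junk-freeness pin (J), analytic letter (A) over ADMISSIBLE run-A fields and eleven
numerals carried VERBATIM; (D4) on the admissible bundles (displayed).  Spine side: N20 ∕ N21 ∕ the keyed extraction clause at `SRec₁₃CoPH cr` and the home-keyed N19′ `NE7.Core` edge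
(displayed, as XXXVIIIᶜᵒᴾᴴ).  Every hypothesis 0∕1 today. [bookkeeping] -/
theorem spine_rec13CCoPH_at_readingAdm₁₃CoPH
    (h14 : ∀ (F : T4Family) (D : Datum F N) (h : IsDatumOfRecord₁₃CCoPH F N D) (g₀ : ℕ → ℝ) (os : List (ULoop F)), N14At (ne1 F h.params g₀ os))
    (h15 : ∀ (F : T4Family) (D : Datum F N) (h : IsDatumOfRecord₁₃CCoPH F N D) (g₀ : ℕ → ℝ) (os : List (ULoop F)) (k : ℕ),
      N15At (ne2OfRecord₁₁ (ne2 F h.params g₀ os k)))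
    (h16 : ∀ (F : T4Family), (∃ D : Datum F N, IsDatumOfRecord₁₃CCoPH F N D) →
      InEndRegime (ne3OfRecord₁₁ F (ne3ConstLayerOfRecord₁₁ F N (ℓ₃ F))) ∧ LeafSlot (ne3OfRecord₁₁ F (ne3ConstLayerOfRecord₁₁ F N (ℓ₃ F))))
    (h18 : S_N18 (RRec₁₃CoPH (readingOfRecord₁₃CoPH
      (fun F θ => ReadingData.ofRecordAdm F θ.τ9.M N (S F θ) (sp F θ) (gauge F θ) (hg F θ) (T₀ F θ) (hT₀ F θ) (li F θ)) ℓ₃ ne2 ne1)))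
    -- N22 ⟸ N18 (dag-n22-e module 8a″, analytic sup-letter currency): (J), (A) over ADMISSIBLE run-A fields, eleven numerals — verbatim
    (hjunk : ∀ (F : T4Family) (θ : Stage13HParams F N), θ.Provisos₁₃CoPH F N → θ.Admissible F N →
      ∀ (k : ℕ) (X : Node00.W1.Dom (F.P k) θ.τ9.M), k < X.1 → ∀ (g : ℕ → ℝ) (φ : CPair (F.P k) (MatA N)), functionalC (S F θ k) g φ X = 0)
    (hA : ∀ (F : T4Family) (θ : Stage13HParams F N), θ.Provisos₁₃CoPH F N → θ.Admissible F N → ∀ (k : ℕ),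
      ∀ g ∈ Window θ.γ, ∀ (U : AdmBg F θ.τ9.M N (sp F θ) k) (X : Node00.W1.Dom (F.P k) θ.τ9.M) (i : ℕ), i < X.1 →
        ∃ (Fz : ℂ → ℂ) (Dset : Set ℂ), DifferentiableOn ℂ Fz Dset ∧
          (∀ z ∈ Dset, ‖Fz z‖ ≤ (li F θ).A * (li F θ).μ ^ (X.1 - 1 - i) * Real.exp (-((li F θ).κ * (domSys (F.P k) θ.τ9.M X.1).dj X.2))) ∧
          (∀ t ∈ Ioc (0 : ℝ) θ.γ, closedBall (t : ℂ) (li F θ).r ⊆ Dset) ∧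
          (∀ t ∈ Ioc (0 : ℝ) θ.γ, Fz t = ((functionalC (S F θ k) (Function.update g i t) (ofBackgroundC (ιSU N) U.1) X).re : ℂ)))
    (hnum : ∀ (F : T4Family) (θ : Stage13HParams F N), θ.Provisos₁₃CoPH F N → θ.Admissible F N →
      0 < (li F θ).C₀ ∧ 0 < (li F θ).θ₅ ∧ (li F θ).θ₅ < 1 ∧ 0 ≤ (li F θ).C₅ ∧ 2 * (li F θ).C₅ / (1 - (li F θ).θ₅) ≤ (li F θ).C₀ ∧ 0 < (li F θ).A ∧
        (li F θ).θ₅ ≤ (li F θ).μ ∧ (li F θ).C₀ ≤ 2 * (li F θ).A ∧ 0 < (li F θ).r ∧ 0 < (li F θ).s ∧ (li F θ).s < 1)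
    (hD4 : ∀ (F : T4Family) (D : Datum F N) (h : IsDatumOfRecord₁₃CCoPH F N D) (k : ℕ), ReadOutAt D (u3OfRecord₁₃ h.params.toStage13Params
      ((ReadingData.ofRecordAdm F h.params.τ9.M N (S F h.params) (sp F h.params) (gauge F h.params) (hg F h.params) (T₀ F h.params) (hT₀ F h.params)
        (li F h.params)).u3Objects h.params.γ) k))
    (hx' : S_N27x (fun F D w => IsRecordOfRecord₁₃CCoPH F N D w) (SRec₁₃CoPH cr)) (h20 : S_N20 (SRec₁₃CoPH cr)) (h21 : S_N21 (SRec₁₃CoPH cr))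
    (h19 : ∀ (F : T4Family) (θ : Stage13HParams F N) (hP : θ.Provisos₁₃CoPH F N), θ.Admissible F N → ∀ (g₀ : ℕ → ℝ) (os : List (ULoop F))
      (h : IsDatumOfRecord₁₃CCoPH F N (datumOfRecord₁₃CoPH F N θ hP)) (k : ℕ),
      RatesAt (datumOfRecord₁₃CoPH F N θ hP) (rateCarriersOfRecord₁₃CoPH (readingOfRecord₁₃CoPH
        (fun F θ => ReadingData.ofRecordAdm F θ.τ9.M N (S F θ) (sp F θ) (gauge F θ) (hg F θ) (T₀ F θ) (hT₀ F θ) (li F θ)) ℓ₃ ne2 ne1)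
          F h.params h.provisos g₀ os k) → letI := (cr F θ hP g₀ os).dec
        ∃ δ : ℕ → ℝ, NE7.Core (cr F θ hP g₀ os).l₀ (cr F θ hP g₀ os).vol (cr F θ hP g₀ os).T (cr F θ hP g₀ os).Bad
          (fun K t τ => (cr F θ hP g₀ os).A K t τ - (cr F θ hP g₀ os).shA K t τ) (fun K t τ => (cr F θ hP g₀ os).B K t τ - (cr F θ hP g₀ os).shB K t τ) δ ∧
          Summable δ) :
    Spine (N := N) fun F D w => IsRecordOfRecord₁₃CCoPH F N D w :=
  spine_rec13CCoPH_at_readingOfRecord₁₃CoPH cr _ ℓ₃ ne2 ne1 ((s_N14_readingOfRecord₁₃CoPH_iff _ ℓ₃ ne2 ne1).mpr h14) ((s_N15_readingOfRecord₁₃CoPH_iff _ ℓ₃ ne2 ne1).mpr h15)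
    (s_N16_rRec₁₃CoPH_of_constLayer_leafSlot (readingOfRecord₁₃CoPH _ ℓ₃ ne2 ne1) (fun F => ne3ConstLayerOfRecord₁₁ F N (ℓ₃ F)) (fun _ _ _ _ _ _ => rfl) h16) h18
    (s_N22_readingOfRecord₁₃CoPH_ofRecordAdm_of_s_N18_analytic S sp gauge hg T₀ hT₀ li ℓ₃ ne2 ne1 h18 hjunk hA hnum)
    ((s_D4_readingOfRecord₁₃CoPH_iff _ ℓ₃ ne2 ne1).mpr hD4) hx' h20 h21 h19

open Classical in
/-- **THE SAME WITH N18 SUPPLIED BY dag-n18-d's ₁₃ HOME THEOREM IN THE (2.38)-ENVELOPE CURRENCY** (module 18 `YMDAG.N18.W1Reading.s_N18_rRec₁₃CoPH_readingAdm_of_envelope_bound238_pin` at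
`hpin := readingOfRecord₁₃CoPH_u3 …`, its hypothesis VERBATIM: per admissible Stage-13 tuple with provisos and run length `k` — THE END's data (i) over the carriers of the admissible
level pairing (step models `Mb b`, the `locE`-read-out action `act`, L01–L03 ∕ L07–L09 on the window, the numerals), (ii) the towers' H-layer data ON THE TABLES for both runs
(`SpRestr`, `AnalyticH`, the (2.38) envelope `Bound238` with `A_A`, `A_B`), and the domination of THE END's letters by the reading's `li F θ`).  So the rate side displays N14 · N15 ·
`InEndRegime ∧ LeafSlot` · (D4) and the producers' own inputs only. [bookkeeping] -/
theorem spine_rec13CCoPH_at_readingAdm₁₃CoPH_of_envelope_bound238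
    (h14 : ∀ (F : T4Family) (D : Datum F N) (h : IsDatumOfRecord₁₃CCoPH F N D) (g₀ : ℕ → ℝ) (os : List (ULoop F)), N14At (ne1 F h.params g₀ os))
    (h15 : ∀ (F : T4Family) (D : Datum F N) (h : IsDatumOfRecord₁₃CCoPH F N D) (g₀ : ℕ → ℝ) (os : List (ULoop F)) (k : ℕ),
      N15At (ne2OfRecord₁₁ (ne2 F h.params g₀ os k)))
    (h16 : ∀ (F : T4Family), (∃ D : Datum F N, IsDatumOfRecord₁₃CCoPH F N D) →
      InEndRegime (ne3OfRecord₁₁ F (ne3ConstLayerOfRecord₁₁ F N (ℓ₃ F))) ∧ LeafSlot (ne3OfRecord₁₁ F (ne3ConstLayerOfRecord₁₁ F N (ℓ₃ F))))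
    (h18 : ∀ (F : T4Family) (θ : Stage13HParams F N), θ.Provisos₁₃CoPH F N → θ.Admissible F N → ∀ k : ℕ,
      ∃ (Op : Type) (_ : NormedAddCommGroup Op) (_ : NormedSpace ℂ Op) (Hist : Type) (_ : NormedAddCommGroup Hist) (_ : NormedSpace ℂ Hist)
        (Mb : ℝ → StepModel (LevelPairing.ofRecordAdm F θ.τ9.M N k (sp F θ) (gauge F θ k) (hg F θ k) (T₀ F θ k) (hT₀ F θ k)).carriers Op Hist)
        (act : ℝ → (j : ℕ) → Op × Hist → TDom 4 (domCount (F.P k) θ.τ9.M j) → ℂ) (γ' C3 ε₁ Rd κ A_A A_B E₁ δ δ' θr θ' cH ω ρ₀ B : ℝ) (k₀ : ℕ),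
        -- (i) the END's data over the carriers of the admissible level pairing
        (∀ b : ℝ, 0 < b → b ≤ γ' → ∀ (X : Node00.W1.Dom (F.P k) θ.τ9.M) (z : Op × Hist),
          (Mb b).Out X.1 z.1 z.2 X =
            locE (TTouch (d := 4) (N := domCount (F.P k) θ.τ9.M X.1)) (fun Z : (tsys 4 (domCount (F.P k) θ.τ9.M X.1)).Dom => Z.1)
              (act b X.1 z) X.2.1) ∧
        0 ≤ C3 ∧ 0 ≤ ε₁ ∧ 0 ≤ κ ∧ κ + 2 * (64 * Real.log 162) + 2 ≤ Rd ∧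
        C3 * ε₁ * Real.exp (5 * κ + 1) * K₀ 64 8 * 9 * 64 ≤ 1 ∧
        (∀ b : ℝ, 0 < b → b ≤ γ' → ∀ j, ∀ g ∈ Window γ',
          ∀ (U : (LevelPairing.ofRecordAdm F θ.τ9.M N k (sp F θ) (gauge F θ k) (hg F θ k) (T₀ F θ k) (hT₀ F θ k)).BgB) (q : Op × Hist),
          q ∈ (Mb b).Base j g U →
          ∃ V : Set (Op × Hist), IsOpen V ∧ (Mb b).box j q ⊆ V ∧
            (∀ Z : TDom 4 (domCount (F.P k) θ.τ9.M j), DifferentiableOn ℂ (fun z : Op × Hist => act b j z Z) V) ∧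
            (∀ z ∈ V, ∀ Z : TDom 4 (domCount (F.P k) θ.τ9.M j), ‖act b j z Z‖ ≤ C3 * ε₁ * Real.exp (-(Rd * torusTreeLen Z.1)))) ∧
        (∀ b : ℝ, 0 < b → b ≤ γ' → L01 (Mb b)
          ((LevelPairing.ofRecordAdm F θ.τ9.M N k (sp F θ) (gauge F θ k) (hg F θ k) (T₀ F θ k) (hT₀ F θ k)).EA (S F θ k)) (Window γ')) ∧
        (∀ b : ℝ, 0 < b → b ≤ γ' → L02 (Mb b)
          ((LevelPairing.ofRecordAdm F θ.τ9.M N k (sp F θ) (gauge F θ k) (hg F θ k) (T₀ F θ k) (hT₀ F θ k)).EB (S F θ (k + 1)) b)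
          (Window γ')) ∧
        (∀ b : ℝ, 0 < b → b ≤ γ' → L03 (Mb b)
          ((LevelPairing.ofRecordAdm F θ.τ9.M N k (sp F θ) (gauge F θ k) (hg F θ k) (T₀ F θ k) (hT₀ F θ k)).EB (S F θ (k + 1)) b)
          (Window γ')) ∧
        (∀ b : ℝ, 0 < b → b ≤ γ' → L07 (Mb b) (Window γ') δ θr) ∧
        (∀ b : ℝ, 0 < b → b ≤ γ' → L08 (Mb b) (Window γ') κ (Real.exp 1 * 9 * 64 * K₀ 64 8 ^ 2 * A_B) δ' θr) ∧
        (∀ b : ℝ, 0 < b → b ≤ γ' → L09aff (Mb b) (Window γ')) ∧ (∀ b : ℝ, 0 < b → b ≤ γ' → L09blind (Mb b) (Window γ')) ∧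
        (∀ b : ℝ, 0 < b → b ≤ γ' → L09hom (Mb b) (Window γ')) ∧ (∀ b : ℝ, 0 < b → b ≤ γ' → L09unit (Mb b) (Window γ') κ E₁ cH ω) ∧
        0 < E₁ ∧ 0 ≤ δ + δ' ∧ 0 ≤ θr ∧ θr ≤ θ' ∧ θ' ≤ 1 ∧ 0 ≤ cH ∧ 0 < ω ∧ ρ₀ < 1 ∧
        (δ + δ') * θr ^ k₀ +
            cH * (Real.exp 1 * 9 * 64 * K₀ 64 8 ^ 2 * A_A + Real.exp 1 * 9 * 64 * K₀ 64 8 ^ 2 * A_B) / (1 - ω) ≤ ρ₀ ∧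
        0 ≤ B ∧ (∀ k < k₀, Real.exp 1 * 9 * 64 * K₀ 64 8 ^ 2 * A_A + Real.exp 1 * 9 * 64 * K₀ 64 8 ^ 2 * A_B ≤ B * θr ^ k) ∧
        Real.exp 1 * 9 * 64 * K₀ 64 8 ^ 2 * C3 * cH * ε₁ < (θ' - ω) * (1 - ρ₀) ∧
        -- (ii) the towers' H-layer data in the configuration direction ON THE TABLES, both runs
        (∀ m, SpRestr (sp F θ k (m + 1))) ∧
        (∀ m, (S F θ k m).AnalyticH (box γ' m) (sp F θ k (m + 1))) ∧ (∀ m, (S F θ k m).Bound238 (box γ' m) (sp F θ k (m + 1)) A_A Rd) ∧ 0 ≤ A_A ∧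
        A_A * Real.exp (5 * κ + 1) * K₀ 64 8 * 9 * 64 < 1 ∧
        (∀ m, SpRestr (sp F θ (k + 1) (m + 1))) ∧
        (∀ m, (S F θ (k + 1) m).AnalyticH (box γ' m) (sp F θ (k + 1) (m + 1))) ∧
        (∀ m, (S F θ (k + 1) m).Bound238 (box γ' m) (sp F θ (k + 1) (m + 1)) A_B Rd) ∧
        0 ≤ A_B ∧ A_B * Real.exp (5 * κ + 1) * K₀ 64 8 * 9 * 64 < 1 ∧
        -- the reading's letters dominate the END's
        θ.γ ≤ γ' ∧ (li F θ).κ ≤ κ ∧ θ' ≤ (li F θ).θ₅ ∧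
        (Real.exp 1 * 9 * 64 * K₀ 64 8 ^ 2 * (C3 * ε₁) / (1 - ρ₀) * (δ + δ') + B) * (θ' - ω) /
            (θ' - (ω + Real.exp 1 * 9 * 64 * K₀ 64 8 ^ 2 * (C3 * ε₁) / (1 - ρ₀) * cH)) ≤ (li F θ).C₅)
    -- N22 ⟸ N18 (dag-n22-e module 8a″, analytic sup-letter currency): (J), (A) over ADMISSIBLE run-A fields, eleven numerals — verbatim
    (hjunk : ∀ (F : T4Family) (θ : Stage13HParams F N), θ.Provisos₁₃CoPH F N → θ.Admissible F N →
      ∀ (k : ℕ) (X : Node00.W1.Dom (F.P k) θ.τ9.M), k < X.1 → ∀ (g : ℕ → ℝ) (φ : CPair (F.P k) (MatA N)), functionalC (S F θ k) g φ X = 0)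
    (hA : ∀ (F : T4Family) (θ : Stage13HParams F N), θ.Provisos₁₃CoPH F N → θ.Admissible F N → ∀ (k : ℕ),
      ∀ g ∈ Window θ.γ, ∀ (U : AdmBg F θ.τ9.M N (sp F θ) k) (X : Node00.W1.Dom (F.P k) θ.τ9.M) (i : ℕ), i < X.1 →
        ∃ (Fz : ℂ → ℂ) (Dset : Set ℂ), DifferentiableOn ℂ Fz Dset ∧
          (∀ z ∈ Dset, ‖Fz z‖ ≤ (li F θ).A * (li F θ).μ ^ (X.1 - 1 - i) * Real.exp (-((li F θ).κ * (domSys (F.P k) θ.τ9.M X.1).dj X.2))) ∧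
          (∀ t ∈ Ioc (0 : ℝ) θ.γ, closedBall (t : ℂ) (li F θ).r ⊆ Dset) ∧
          (∀ t ∈ Ioc (0 : ℝ) θ.γ, Fz t = ((functionalC (S F θ k) (Function.update g i t) (ofBackgroundC (ιSU N) U.1) X).re : ℂ)))
    (hnum : ∀ (F : T4Family) (θ : Stage13HParams F N), θ.Provisos₁₃CoPH F N → θ.Admissible F N →
      0 < (li F θ).C₀ ∧ 0 < (li F θ).θ₅ ∧ (li F θ).θ₅ < 1 ∧ 0 ≤ (li F θ).C₅ ∧ 2 * (li F θ).C₅ / (1 - (li F θ).θ₅) ≤ (li F θ).C₀ ∧ 0 < (li F θ).A ∧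
        (li F θ).θ₅ ≤ (li F θ).μ ∧ (li F θ).C₀ ≤ 2 * (li F θ).A ∧ 0 < (li F θ).r ∧ 0 < (li F θ).s ∧ (li F θ).s < 1)
    (hD4 : ∀ (F : T4Family) (D : Datum F N) (h : IsDatumOfRecord₁₃CCoPH F N D) (k : ℕ), ReadOutAt D (u3OfRecord₁₃ h.params.toStage13Params
      ((ReadingData.ofRecordAdm F h.params.τ9.M N (S F h.params) (sp F h.params) (gauge F h.params) (hg F h.params) (T₀ F h.params) (hT₀ F h.params)
        (li F h.params)).u3Objects h.params.γ) k))
    (hx' : S_N27x (fun F D w => IsRecordOfRecord₁₃CCoPH F N D w) (SRec₁₃CoPH cr)) (h20 : S_N20 (SRec₁₃CoPH cr)) (h21 : S_N21 (SRec₁₃CoPH cr))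
    (h19 : ∀ (F : T4Family) (θ : Stage13HParams F N) (hP : θ.Provisos₁₃CoPH F N), θ.Admissible F N → ∀ (g₀ : ℕ → ℝ) (os : List (ULoop F))
      (h : IsDatumOfRecord₁₃CCoPH F N (datumOfRecord₁₃CoPH F N θ hP)) (k : ℕ),
      RatesAt (datumOfRecord₁₃CoPH F N θ hP) (rateCarriersOfRecord₁₃CoPH (readingOfRecord₁₃CoPH
        (fun F θ => ReadingData.ofRecordAdm F θ.τ9.M N (S F θ) (sp F θ) (gauge F θ) (hg F θ) (T₀ F θ) (hT₀ F θ) (li F θ)) ℓ₃ ne2 ne1)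
          F h.params h.provisos g₀ os k) → letI := (cr F θ hP g₀ os).dec
        ∃ δ : ℕ → ℝ, NE7.Core (cr F θ hP g₀ os).l₀ (cr F θ hP g₀ os).vol (cr F θ hP g₀ os).T (cr F θ hP g₀ os).Bad
          (fun K t τ => (cr F θ hP g₀ os).A K t τ - (cr F θ hP g₀ os).shA K t τ) (fun K t τ => (cr F θ hP g₀ os).B K t τ - (cr F θ hP g₀ os).shB K t τ) δ ∧
          Summable δ) :
    Spine (N := N) fun F D w => IsRecordOfRecord₁₃CCoPH F N D w :=
  spine_rec13CCoPH_at_readingAdm₁₃CoPH cr S sp gauge hg T₀ hT₀ li ℓ₃ ne2 ne1 h14 h15 h16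
    (s_N18_rRec₁₃CoPH_readingAdm_of_envelope_bound238_pin _ S sp gauge hg T₀ hT₀ li (readingOfRecord₁₃CoPH_u3 _ ℓ₃ ne2 ne1) h18) hjunk hA hnum hD4 hx' h20 h21 h19

end Canonical

/-! ## §2 The regime-restricted home at the admissible reading of record, any regime `Rg` -/

section Regime

variable (Rg : (F : T4Family) → Stage13HParams F N → Prop)

/-- **N27 = B5 AT THE REGIME RECORD CLASS `IsRecordOfRecord₁₃CCoPHOn F N Rg` FROM THE SLOTS AT THE REGIME HOME OF THE ADMISSIBLE READING OF RECORD, ANY `Rg` — N17 AND N22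
ELIMINATED, N18 IN CLOSED FORM AT θ** (XLᶜᵒᴾᴴ `spine_rec13CCoPHOn_at_readingOfRecord₁₃CoPH` at the admissible `w1`).  For every family and every Stage-13 tuple `θ` with provisos IN THE
REGIME, admissible: NE1′ on `ne1 F θ g₀ os`, NE2 on `ne2 F θ g₀ os k` (displayed); NE3 as `InEndRegime ∧ LeafSlot` once per guarded family (dag-n16-e module 19
`s_N16_rRec₁₃CoPHOn_ofRecord_of_leafSlot`); N18 DISPLAYED IN CLOSED FORM (dag-n18-d module 18 `n18At_u3OfRecord₁₃_readingAdm_iff`, `Iff.rfl`, through 6″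
`s_N18_readingOfRecord₁₃CoPHOn_iff`): for every run length `k`, member `b ∈ ]0, θ.γ]`, history `g ∈ ]0, θ.γ]^ℕ`, every ADMISSIBLE run-B gauge field `U` of the `(k+1)`-th torus — read inside
the table `sp F θ (k+1)` — and run-A domain `(j, X)`, `|Re E^{(j)}_{S F θ k}(X; g; (ι(T₀ F θ k U), 0)) − Re E^{(j+1)}_{S F θ (k+1)}(πX; b∷g; (ιU, 0))| ≤ C₅·θ₅^j·e^{−κ d_j(X)}` with the
letters `li F θ` (= [I] (1.18)'s regime exactly); N22 ELIMINATED given N18 by dag-n22-e's regime edge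
`YMDAG.N22.s_N22_readingOfRecord₁₃CoPHOn_ofRecordAdm_of_s_N18_stripBound` (module 8a″) in the STRIP currency on the reading's OWN table `sp F θ k` — (J), twelve numerals and STRIP-(1.18)
for the terms `E^{(j)}_{S F θ k}(Y; g[i ↦ ·]; ψ)` at the configurations `ψ ∈ sp F θ k j Y` carried VERBATIM, NO readings clause (BY TYPE at the admissible reading); (D4) on the
admissible bundles at θ (displayed).  Spine side: N20 ∕ N21 at `SRec₁₃CoPHOn cr Rg`, the guarded keyed extraction clause, the same-tuple all-run-lengths N19′ edge (displayed, as XXXIXᶜᵒᴾᴴ).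
At `Rg := Node00.unityNondeg₁₃H N`, `N = 2` THE ITEM is XXXVII-class leaf §4 `spineGivenEndpointR13CoPH_of_spine_rec13CCoPHOn` of this. [bookkeeping] -/
theorem spine_rec13CCoPHOn_at_readingAdm₁₃CoPH
    (h14 : ∀ (F : T4Family) (θ : Stage13HParams F N), θ.Provisos₁₃CoPH F N → Rg F θ → θ.Admissible F N → ∀ (g₀ : ℕ → ℝ) (os : List (ULoop F)),
      N14At (ne1 F θ g₀ os))
    (h15 : ∀ (F : T4Family) (θ : Stage13HParams F N), θ.Provisos₁₃CoPH F N → Rg F θ → θ.Admissible F N → ∀ (g₀ : ℕ → ℝ) (os : List (ULoop F)) (k : ℕ),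
      N15At (ne2OfRecord₁₁ (ne2 F θ g₀ os k)))
    (h16 : ∀ (F : T4Family), (∃ θ : Stage13HParams F N, θ.Provisos₁₃CoPH F N ∧ Rg F θ ∧ θ.Admissible F N) →
      InEndRegime (ne3OfRecord₁₁ F (ne3ConstLayerOfRecord₁₁ F N (ℓ₃ F))) ∧ LeafSlot (ne3OfRecord₁₁ F (ne3ConstLayerOfRecord₁₁ F N (ℓ₃ F))))
    (h18 : ∀ (F : T4Family) (θ : Stage13HParams F N), θ.Provisos₁₃CoPH F N → Rg F θ → θ.Admissible F N → ∀ (k : ℕ) (b : ℝ), 0 < b → b ≤ θ.γ →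
      ∀ g ∈ Window θ.γ,
        ∀ (U : {U : GaugeField (F.P (k + 1)) 0 (Node00.SU N) //
            ∀ (j : ℕ) (Y : (domSys (F.P (k + 1)) θ.τ9.M j).Dom), ofBackgroundC (ιSU N) U ∈ sp F θ (k + 1) j Y})
          (X : Node00.W1.Dom (F.P k) θ.τ9.M),
        |(functionalC (S F θ k) g (ofBackgroundC (ιSU N) (T₀ F θ k U.1)) X).re -
            (functionalC (S F θ (k + 1)) (prependCoupling b g) (ofBackgroundC (ιSU N) U.1) (pairOfRecord F θ.τ9.M k X)).re| ≤
          (li F θ).C₅ * (li F θ).θ₅ ^ X.1 * Real.exp (-((li F θ).κ * (domSys (F.P k) θ.τ9.M X.1).dj X.2)))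
    -- N22 ⟸ N18 (dag-n22-e module 8a″, STRIP currency on the reading's OWN table, NO readings clause): (J), twelve numerals, STRIP-(1.18) — verbatim
    (hjunk : ∀ (F : T4Family) (θ : Stage13HParams F N), θ.Provisos₁₃CoPH F N → Rg F θ → θ.Admissible F N →
      ∀ (k : ℕ) (X : Node00.W1.Dom (F.P k) θ.τ9.M), k < X.1 → ∀ (g : ℕ → ℝ) (φ : CPair (F.P k) (MatA N)), functionalC (S F θ k) g φ X = 0)
    (hnum : ∀ (F : T4Family) (θ : Stage13HParams F N), θ.Provisos₁₃CoPH F N → Rg F θ → θ.Admissible F N →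
      0 < (li F θ).C₀ ∧ 0 < (li F θ).θ₅ ∧ (li F θ).θ₅ < 1 ∧ 0 ≤ (li F θ).C₅ ∧ 2 * (li F θ).C₅ / (1 - (li F θ).θ₅) ≤ (li F θ).C₀ ∧ 0 < (li F θ).A ∧
        (li F θ).θ₅ ≤ (li F θ).μ ∧ (li F θ).C₀ ≤ 2 * (li F θ).A ∧ 0 < (li F θ).r ∧ 0 < (li F θ).s ∧ (li F θ).s < 1 ∧ 1 ≤ (li F θ).μ)
    (hstrip : ∀ (F : T4Family) (θ : Stage13HParams F N), θ.Provisos₁₃CoPH F N → Rg F θ → θ.Admissible F N → ∀ (k : ℕ),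
      ∀ (j : ℕ) (g : ℕ → ℝ), g ∈ Window θ.γ → ∀ (i : ℕ) (Y : (domSys (F.P k) θ.τ9.M j).Dom) (ψ : CPair (F.P k) (MatA N)), ψ ∈ sp F θ k j Y →
        ∃ (Ec : ℂ → ℂ) (O : Set ℂ), IsOpen O ∧ (∀ t ∈ Ioc (0 : ℝ) θ.γ, closedBall (t : ℂ) (li F θ).r ⊆ O) ∧ DifferentiableOn ℂ Ec O ∧
          (∀ z ∈ O, ‖Ec z‖ ≤ (li F θ).A * Real.exp (-((li F θ).κ * torusTreeLen Y.1))) ∧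
          (∀ t ∈ Ioc (0 : ℝ) θ.γ, Ec t = termC (S F θ k) j Y (Function.update g i t) ψ))
    (hD4 : ∀ (F : T4Family) (θ : Stage13HParams F N) (hP : θ.Provisos₁₃CoPH F N), Rg F θ → θ.Admissible F N → ∀ k : ℕ,
      ReadOutAt (datumOfRecord₁₃CoPH F N θ hP) (u3OfRecord₁₃ θ.toStage13Params
        ((ReadingData.ofRecordAdm F θ.τ9.M N (S F θ) (sp F θ) (gauge F θ) (hg F θ) (T₀ F θ) (hT₀ F θ) (li F θ)).u3Objects θ.γ) k))
    (h20 : S_N20 (SRec₁₃CoPHOn cr Rg)) (h21 : S_N21 (SRec₁₃CoPHOn cr Rg))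
    (hx : ∀ (F : T4Family) (θ : Stage13HParams F N) (hP : θ.Provisos₁₃CoPH F N), Rg F θ → θ.Admissible F N →
      B16.EndStatementBPrinted (datumOfRecord₁₃CoPH F N θ hP).C → DagBinding.EndpointExistence (datumOfRecord₁₃CoPH F N θ hP).C.toB12 →
        ForSmallCouplings (datumOfRecord₁₃CoPH F N θ hP) fun g₀ => ∀ os : List (ULoop F),
          0 < (cr F θ hP g₀ os).l₀ ∧ 0 < (cr F θ hP g₀ os).vol ∧
          (∀ (K : ℕ) (t : ℝ), |t| ≤ (cr F θ hP g₀ os).l₀ →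
            T4GenFunBounds.schemeZ ((datumOfRecord₁₃CoPH F N θ hP).scheme g₀) os ((cr F θ hP g₀ os).K₀ + K) t =
              ∑ τ ∈ (cr F θ hP g₀ os).T K, (cr F θ hP g₀ os).A K t τ) ∧
          (∀ (K : ℕ) (t : ℝ), |t| ≤ (cr F θ hP g₀ os).l₀ →
            T4GenFunBounds.schemeZ ((datumOfRecord₁₃CoPH F N θ hP).scheme g₀) os ((cr F θ hP g₀ os).K₀ + K + 1) t =
              ∑ τ ∈ (cr F θ hP g₀ os).T K, (cr F θ hP g₀ os).B K t τ))
    (h19 : ∀ (F : T4Family) (θ : Stage13HParams F N) (hP : θ.Provisos₁₃CoPH F N), Rg F θ → θ.Admissible F N → ∀ (g₀ : ℕ → ℝ) (os : List (ULoop F)),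
      (∀ k : ℕ, RatesAt (datumOfRecord₁₃CoPH F N θ hP) (rateCarriersOfRecord₁₃CoPH (readingOfRecord₁₃CoPH
        (fun F θ => ReadingData.ofRecordAdm F θ.τ9.M N (S F θ) (sp F θ) (gauge F θ) (hg F θ) (T₀ F θ) (hT₀ F θ) (li F θ)) ℓ₃ ne2 ne1) F θ hP g₀ os k)) →
        letI := (cr F θ hP g₀ os).dec
        ∃ δ : ℕ → ℝ, NE7.Core (cr F θ hP g₀ os).l₀ (cr F θ hP g₀ os).vol (cr F θ hP g₀ os).T (cr F θ hP g₀ os).Bad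
          (fun K t τ => (cr F θ hP g₀ os).A K t τ - (cr F θ hP g₀ os).shA K t τ) (fun K t τ => (cr F θ hP g₀ os).B K t τ - (cr F θ hP g₀ os).shB K t τ) δ ∧
          Summable δ) :
    Spine (N := N) fun F D w => Node00.IsRecordOfRecord₁₃CCoPHOn F N Rg D w :=
  have h18' : S_N18 (RRec₁₃CoPHOn (readingOfRecord₁₃CoPH
      (fun F θ => ReadingData.ofRecordAdm F θ.τ9.M N (S F θ) (sp F θ) (gauge F θ) (hg F θ) (T₀ F θ) (hT₀ F θ) (li F θ)) ℓ₃ ne2 ne1) Rg) :=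
    (s_N18_readingOfRecord₁₃CoPHOn_iff _ ℓ₃ ne2 ne1 Rg).mpr fun F θ hP hRg hθ k =>
      (n18At_u3OfRecord₁₃_readingAdm_iff θ.toStage13Params k (S F θ) (sp F θ) (gauge F θ) (hg F θ) (T₀ F θ) (hT₀ F θ) (li F θ)).mpr (h18 F θ hP hRg hθ k)
  spine_rec13CCoPHOn_at_readingOfRecord₁₃CoPH cr _ ℓ₃ ne2 ne1 Rg
    ((s_N14_rRec₁₃CoPHOn_iff _ Rg).mpr fun F θ hP hRg hθ g₀ os => h14 F θ hP hRg hθ g₀ os)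
    ((s_N15_rRec₁₃CoPHOn_iff _ Rg).mpr fun F θ hP hRg hθ g₀ os k => h15 F θ hP hRg hθ g₀ os k)
    (s_N16_rRec₁₃CoPHOn_ofRecord_of_leafSlot (readingOfRecord₁₃CoPH _ ℓ₃ ne2 ne1) Rg ℓ₃ (fun _ _ _ _ _ _ => rfl) h16)
    h18' (s_N22_readingOfRecord₁₃CoPHOn_ofRecordAdm_of_s_N18_stripBound S sp gauge hg T₀ hT₀ li ℓ₃ ne2 ne1 Rg h18' hjunk hnum hstrip)
    ((s_D4_rRec₁₃CoPHOn_iff _ Rg).mpr fun F θ hP hRg hθ _ _ k => hD4 F θ hP hRg hθ k) h20 h21 hx h19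

end Regime

end Summit.QuantumFields.YangMills.Theorems.BalabanUVNodesN27SpineRecord
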